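import Summits.BirchSwinnertonDyer.BirchSwinnertonDyer.Theorems.EisensteinPrimesLineCharactersAtMultiplicativePlace
import Literature.NumberTheory.EllipticCurves.HasseWeilGoodReductionFrobeniusProofs
import HarnessLib

/-!
# At a multiplicative place `ℓ ≠ p` the SCALARS of a Frobenius on a rational `p`-line and on its quotient are
# `{a_ℓ·ℓ, a_ℓ}` — presentation-free form of x2-p1-w7's `…LineCharactersAtMultiplicativePlace`

Cell `bsd-eis`, width seat `bsd-line-x1-p1-w2` gen 23, crux 2 `GoodLatticeBDPValue` (stmt-BirchSwinnertonDyer-19032), line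
`halves` v33N; helper `--supports`, closes no stub. PROVED, no named fact, no `sorry`.

WHY. The (eq:Euler-comp) step of Castella–Grossi–Lee–Skinner's proof of Thm. 2.2.2 evaluates, at each multiplicative
`ℓ ∥ N`, the local terms `λ(𝒫_w(φ)) + λ(𝒫_w(ψ)) − λ(𝒫_w(E))` through `{φ(ℓ), ψ(ℓ)} = {a_ℓ ℓ, a_ℓ}` (Tate curve at `ℓ`;
Greenberg–Vatsal §2 pp. 14–15).  Width seat x2-p1-w7 proved exactly this for a rational `p`-line whose characters are
PRESENTED by Dirichlet characters `φ mod m`, `ψ mod d` (`lineChars_natCast_of_hasSplitMultiplicativeReductionAt`,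
`lineChars_natCast_of_not_hasSplitMultiplicativeReductionAtPrime`).  The crux-2 content stub 3a-A presents the residual
pair as Teichmüller lifts (`IsResidualPairOver`), i.e. by INTEGER SCALARS `σ • P = n • P`; this file re-runs x2-p1-w7's
engine (`exists_mem_tateLine_eigenvector`, `lineChars_dichotomy`, the Tate-datum quotient sign) with scalar hypotheses
and records WHICH Frobenius is used: `σ₁ = res_v(τ)` for a local arithmetic Frobenius `τ` at a prime `𝔐` of `\bar 𝓞_v`,
which is a GLOBAL arithmetic Frobenius at the prime `𝔓 = v.primeBelow ι 𝔐 ∣ v` of `\bar ℤ`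
(`isArithFrobAt_resGalOfEmb`), so that class-function arguments can move it to any Frobenius above `ℓ`.

* `exists_frob_lineScalars_of_hasSplitMultiplicativeReductionAt` — SPLIT `ℓ ≠ p`: `∃ 𝔓 ∣ v, ∃ σ₁` arithmetic Frobenius
  at `𝔓` such that for EVERY rational `p`-line `Φ₀` and integers `nφ, nψ` with `σ₁ • P = nφ • P` on `Φ₀`,
  `σ₁ • Q − nψ • Q ∈ Φ₀` on `E[p]`: `(nφ, nψ) ≡ (ℓ, 1)` or `(1, ℓ)` (mod `p`).
* `exists_frob_lineScalars_of_not_hasSplitMultiplicativeReductionAtPrime` — NON-SPLIT odd `ℓ ≠ p` (`W` globally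
  minimal): the same with `(−ℓ, −1)` or `(−1, −ℓ)`.

HONEST FRAMING: tool theorems on the tree's own objects (both Tate uniformisation facts are tree THEOREMS); 0 stubs / cells /
labels / tiers move; no summit statement, no case of BSD, no crux or stub is proved here.
References: [GreenbergVatsal2000] §2 pp. 14–15, p. 27; [SilvermanATAEC1994] V.3.1, V.5.2 (c), V.5.3, V.5.4, Ex. 5.11;
[NeukirchANT1999] Ch. I §10 (10.3), Ch. II §9 (9.6); [CastellaGrossiLeeSkinner2022] Thm. 2.2.1 / proof of Thm. 2.2.2.
-/

set_option autoImplicit false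
set_option linter.dupNamespace false

noncomputable section

open scoped Classical

open NumberField IsDedekindDomain Field WeierstrassCurve
  Literature.NumberTheory.EllipticCurves Literature.NumberTheory.GaloisRepresentations
  Literature.NumberTheory.EllipticCurves.GreenbergSelmer
  Literature.NumberTheory.EllipticCurves.Rank1Residual
  Literature.NumberTheory.EllipticCurves.GreenbergVatsal2000
  Summit.BirchSwinnertonDyer.Rank1Residual.X2.GreenbergVatsalTateDatum
  Summit.BirchSwinnertonDyer.Rank1Residual.X2.GreenbergVatsalTateDatumSign
  Summit.BirchSwinnertonDyer.Rank1Residual.X2.GreenbergVatsalTateDatumCofree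
  Summit.BirchSwinnertonDyer.Rank1Residual.X2.GreenbergVatsalTateFrobeniusSign
  Summit.BirchSwinnertonDyer.Rank1Residual.X2
  Summit.BirchSwinnertonDyer.BirchSwinnertonDyer.Theorems.EisensteinPrimesLinePsiAtMultiplicativePrime
  Summit.BirchSwinnertonDyer.BirchSwinnertonDyer.Theorems.EisensteinPrimesLinePhiAtMultiplicativePrime
  Summit.BirchSwinnertonDyer.BirchSwinnertonDyer.Theorems.EisensteinPrimesLineCharactersAtMultiplicativePlace

namespace Summit.BirchSwinnertonDyer.BirchSwinnertonDyer.Theorems.LineScalarsAtMultiplicativePlace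

variable {W : WeierstrassCurve ℚ} [W.IsElliptic] {p : ℕ} [hp : Fact p.Prime]

/-- The restriction `res_v τ ∈ Γ_ℚ` of a local arithmetic Frobenius `τ ∈ Γ_{ℚ_v}` at a prime `𝔐` of `\bar 𝓞_v` is a
global arithmetic Frobenius at the prime `v.primeBelow ι 𝔐 ∣ v` cut out by the tree's embedding `ι : ℚ̄ → ℚ̄_v`
(`closureEmb`; `absGaloisRestrict ℚ ℚ_v = resGalOfEmb ι` by definition; tree `isArithFrobAt_resGalOfEmb`).
[cite: NeukirchANT1999, Ch. II §9 Prop. (9.6)] -/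
theorem isArithFrobAt_absGaloisRestrict_primeBelow {v : HeightOneSpectrum (𝓞 ℚ)}
    {𝔐 : Ideal v.localAbsIntegers} (h𝔐 : 𝔐 ∈ v.localPrimesAbove)
    {τ : absoluteGaloisGroup (v.adicCompletion ℚ)} (hτ : IsArithFrobAt (v.adicCompletionIntegers ℚ) τ 𝔐) :
    v.primeBelow (closureEmb (K := ℚ) (v.adicCompletion ℚ)) 𝔐 ∈ v.primesAbove ∧
      IsArithFrobAt (𝓞 ℚ) (absGaloisRestrict ℚ (v.adicCompletion ℚ) τ)
        (v.primeBelow (closureEmb (K := ℚ) (v.adicCompletion ℚ)) 𝔐) :=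
  ⟨IsDedekindDomain.HeightOneSpectrum.primeBelow_mem_primesAbove h𝔐,
    WeierstrassCurve.isArithFrobAt_resGalOfEmb h𝔐 _ hτ⟩

/-- **SPLIT multiplicative `ℓ ≠ p`, scalar form: `{nφ, nψ} ≡ {ℓ, 1}`.** For `W/ℚ` with split multiplicative reduction at
the place `v = (ℓ)`, `ℓ ≠ p`, there are a prime `𝔓 ∣ v` of `\bar ℤ` and an arithmetic Frobenius `σ₁` at `𝔓` such that for
every rational `p`-line `Φ₀ ≤ E[p]` and all integers `nφ, nψ` with `σ₁ • P = nφ • P` on `Φ₀` and `σ₁ • Q − nψ • Q ∈ Φ₀` on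
`E[p]`: `(nφ, nψ) ≡ (ℓ, 1)` (the line is the Tate line `C_ℓ[p] ≅ μ_p`) or `(1, ℓ)` (the line meets it trivially), mod `p`.
Engine = x2-p1-w7's `lineChars_natCast_of_hasSplitMultiplicativeReductionAt`, verbatim, with the Dirichlet presentation
replaced by scalars. [cite: GreenbergVatsal2000, §2 pp. 14–15 (C ≅ μ, D trivial at a split prime)]
[cite: SilvermanATAEC1994, Thm. V.3.1 (c),(d) and Thm. V.5.3 (a),(b)] [cite: NeukirchANT1999, Ch. I §10 (10.3) and Ch. II §9 Prop. (9.6)] -/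
theorem exists_frob_lineScalars_of_hasSplitMultiplicativeReductionAt {v : HeightOneSpectrum (𝓞 ℚ)} {ℓ : ℕ}
    (hv : (Rat.HeightOneSpectrum.primesEquiv v : ℕ) = ℓ) (hℓp : ℓ ≠ p)
    (hsplit : W.HasSplitMultiplicativeReductionAt v) :
    ∃ 𝔓 ∈ v.primesAbove, ∃ σ₁ : absoluteGaloisGroup ℚ, IsArithFrobAt (𝓞 ℚ) σ₁ 𝔓 ∧
      ∀ {Φ₀ : AddSubgroup (geomTorsion W (p : ℤ))}, IsRationalLine W p Φ₀ →
      ∀ {nφ nψ : ℕ}, (∀ P ∈ Φ₀, σ₁ • P = nφ • P) →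
        (∀ Q : geomTorsion W (p : ℤ), σ₁ • Q - nψ • Q ∈ Φ₀) →
        ((nφ : ZMod p) = (ℓ : ZMod p) ∧ (nψ : ZMod p) = 1) ∨
          ((nφ : ZMod p) = 1 ∧ (nψ : ZMod p) = (ℓ : ZMod p)) := by
  have hpp := hp.out
  obtain ⟨𝔐, h𝔐⟩ := v.localPrimesAbove_nonempty
  obtain ⟨τ, hτ⟩ := IsDedekindDomain.HeightOneSpectrum.exists_isArithFrobAt_localAbsIntegers v h𝔐
  obtain ⟨q, Ψ, hq0, hq1, hsurj, hker, hΨσ, -⟩ :=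
    TateCurve.Silverman1994_thmV53_tateUniformisation_holds W v hsplit
  have hker' : ∀ u : (AlgebraicClosure (v.adicCompletion ℚ))ˣ, Ψ (Additive.ofMul u) = 0 →
      ∃ a : ℤ, (u : AlgebraicClosure (v.adicCompletion ℚ)) =
        algebraMap (v.adicCompletion ℚ) (AlgebraicClosure (v.adicCompletion ℚ)) q ^ a :=
    fun u h ↦ (hker u).1 h
  set N := tateDatum W p Ψ (sign_disj W Ψ 0 (sign_of_equivariant W Ψ hΨσ)) with hN
  set X := N.plus.comap (AddSubgroup.inclusion (geomTorsion_le_geomPrimaryTorsion W p)) with hXdef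
  have hXcard : Nat.card X = p := by
    rw [hXdef, TateLineDecomposition.natCard_comap_eq W p N, hN]
    exact natCard_tateDatum_plus_inf_torsionBy W p Ψ _ hq0 hq1 hker'
  set σ₁ : absoluteGaloisGroup ℚ := absGaloisRestrict ℚ (v.adicCompletion ℚ) τ with hσ₁def
  -- the quotient: `σ₁ ≡ 1`
  have hquot : ∀ Q : geomTorsion W (p : ℤ), σ₁ • Q - (1 : ℤ) • Q ∈ X := fun Q ↦
    TateLineDecomposition.smul_sub_zsmul_mem_comap W p N (g := σ₁) (s := 1) (fun m' ↦ by
      rw [one_zsmul]; exact smul_sub_mem_of_equivariant W p Ψ hΨσ hsurj hker' τ m') Q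
  -- the eigenvector in the Tate line: `σ₁ • P₀ = ℓ • P₀`
  obtain ⟨P₀, hP₀0, hP₀X, hP₀⟩ := exists_mem_tateLine_eigenvector (W := W) hv hℓp h𝔐 hτ hq0 hq1 hker
    (sign_disj W Ψ 0 (sign_of_equivariant W Ψ hΨσ)) (z := 1) (fun u ↦ by rw [hΨσ, one_zsmul])
  obtain ⟨h𝔓, hfrob⟩ := isArithFrobAt_absGaloisRestrict_primeBelow h𝔐 hτ
  refine ⟨_, h𝔓, σ₁, hfrob, fun {Φ₀} hΦ {nφ nψ} hφ hψ ↦ ?_⟩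
  have key := lineChars_dichotomy hΦ.1 hXcard (fun P hP ↦ hΦ.2 σ₁ P hP) hquot hP₀X hP₀0 hP₀ hφ hψ
  simp only [one_mul, Int.cast_natCast, Int.cast_one] at key
  exact key

/-- **NON-SPLIT multiplicative odd `ℓ ≠ p`, scalar form: `{nφ, nψ} ≡ {−ℓ, −1}`.** For `W/ℚ` globally minimal with
non-split multiplicative reduction at the odd prime `ℓ ≠ p` (place `v = (ℓ)`), there are a prime `𝔓 ∣ v` of `\bar ℤ` and an
arithmetic Frobenius `σ₁` at `𝔓` such that for every rational `p`-line `Φ₀` and all integers `nφ, nψ` with `σ₁ • P = nφ • P`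
on `Φ₀` and `σ₁ • Q − nψ • Q ∈ Φ₀` on `E[p]`: `(nφ, nψ) ≡ (−ℓ, −1)` or `(−1, −ℓ)` mod `p` (unramified quadratic twist of
the split picture: a local Frobenius flips `√γ`). Engine = x2-p1-w7's
`lineChars_natCast_of_not_hasSplitMultiplicativeReductionAtPrime`, verbatim, with scalars.
[cite: GreenbergVatsal2000, §2 pp. 14–15] [cite: SilvermanATAEC1994, Ch. V Lemma 5.2 (c), Thm. 5.3 (a),(b), Cor. 5.4, Ex. 5.11 (b)]
[cite: SilvermanAEC2009, VII.5 Prop. 5.1(b)] [cite: NeukirchANT1999, Ch. I §10 (10.3) and Ch. II §9 Prop. (9.6)] -/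
theorem exists_frob_lineScalars_of_not_hasSplitMultiplicativeReductionAtPrime [W.IsGloballyMinimal]
    {v : HeightOneSpectrum (𝓞 ℚ)} {ℓ : ℕ} [hℓ : Fact ℓ.Prime]
    (hv : (Rat.HeightOneSpectrum.primesEquiv v : ℕ) = ℓ) (hℓp : ℓ ≠ p) (hℓ2 : ℓ ≠ 2)
    (hmult : W.HasMultiplicativeReductionAtPrime ℓ) (hns : ¬ W.HasSplitMultiplicativeReductionAtPrime ℓ) :
    ∃ 𝔓 ∈ v.primesAbove, ∃ σ₁ : absoluteGaloisGroup ℚ, IsArithFrobAt (𝓞 ℚ) σ₁ 𝔓 ∧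
      ∀ {Φ₀ : AddSubgroup (geomTorsion W (p : ℤ))}, IsRationalLine W p Φ₀ →
      ∀ {nφ nψ : ℕ}, (∀ P ∈ Φ₀, σ₁ • P = nφ • P) →
        (∀ Q : geomTorsion W (p : ℤ), σ₁ • Q - nψ • Q ∈ Φ₀) →
        ((nφ : ZMod p) = -(ℓ : ZMod p) ∧ (nψ : ZMod p) = -1) ∨
          ((nφ : ZMod p) = -1 ∧ (nψ : ZMod p) = -(ℓ : ZMod p)) := by
  have hpp := hp.out
  have hℓv : ((ℓ : ℕ) : 𝓞 ℚ) ∈ v.asIdeal := natCast_mem_asIdeal_of_primesEquiv_eq hv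
  have hmultAt : W.HasMultiplicativeReductionAt v :=
    GreenbergVatsalStrictSelmerMultiplicative.hasMultiplicativeReductionAt_of_mem W ℓ hmult hℓv
  obtain ⟨𝔐, h𝔐⟩ := v.localPrimesAbove_nonempty
  obtain ⟨τ, hτ⟩ := IsDedekindDomain.HeightOneSpectrum.exists_isArithFrobAt_localAbsIntegers v h𝔐
  obtain ⟨q, t, Ψ, hq0, hq1, ht0, ht2, hsurj, hker, hΨσ, -⟩ :=
    TateCurve.Silverman1994_thmV53_corV54_tateUniformisation_holds W v hmultAt
  have hker' : ∀ u : (AlgebraicClosure (v.adicCompletion ℚ))ˣ, Ψ (Additive.ofMul u) = 0 →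
      ∃ a : ℤ, (u : AlgebraicClosure (v.adicCompletion ℚ)) =
        algebraMap (v.adicCompletion ℚ) (AlgebraicClosure (v.adicCompletion ℚ)) q ^ a :=
    fun u h ↦ (hker u).1 h
  have hflip := frob_apply_sqrt_gamma_ne W hℓ2 hmult hns hℓv h𝔐 hτ t ht0 ht2
  set N := tateDatum W p Ψ (sign_disj W Ψ t hΨσ) with hN
  set X := N.plus.comap (AddSubgroup.inclusion (geomTorsion_le_geomPrimaryTorsion W p)) with hXdef
  have hXcard : Nat.card X = p := by
    rw [hXdef, TateLineDecomposition.natCard_comap_eq W p N, hN]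
    exact natCard_tateDatum_plus_inf_torsionBy W p Ψ _ hq0 hq1 hker'
  set σ₁ : absoluteGaloisGroup ℚ := absGaloisRestrict ℚ (v.adicCompletion ℚ) τ with hσ₁def
  -- the quotient: `σ₁ ≡ −1`
  have hquot : ∀ Q : geomTorsion W (p : ℤ), σ₁ • Q - (-1 : ℤ) • Q ∈ X := fun Q ↦
    TateLineDecomposition.smul_sub_zsmul_mem_comap W p N (g := σ₁) (s := -1) (fun m' ↦ by
      have h := smul_sub_sign_smul_mem W p Ψ t hΨσ hsurj hker' τ m'
      rwa [if_neg hflip] at h) Q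
  -- the eigenvector in the Tate line: `σ₁ • P₀ = (−ℓ) • P₀`
  obtain ⟨P₀, hP₀0, hP₀X, hP₀⟩ := exists_mem_tateLine_eigenvector (W := W) hv hℓp h𝔐 hτ hq0 hq1 hker
    (sign_disj W Ψ t hΨσ) (z := -1) (fun u ↦ by rw [hΨσ τ u, if_neg hflip])
  obtain ⟨h𝔓, hfrob⟩ := isArithFrobAt_absGaloisRestrict_primeBelow h𝔐 hτ
  refine ⟨_, h𝔓, σ₁, hfrob, fun {Φ₀} hΦ {nφ nψ} hφ hψ ↦ ?_⟩
  have key := lineChars_dichotomy hΦ.1 hXcard (fun P hP ↦ hΦ.2 σ₁ P hP) hquot hP₀X hP₀0 hP₀ hφ hψ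
  simp only [neg_one_mul, Int.cast_neg, Int.cast_natCast, Int.cast_one] at key
  exact key

end Summit.BirchSwinnertonDyer.BirchSwinnertonDyer.Theorems.LineScalarsAtMultiplicativePlace

end
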